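import Literature.NumberTheory.ComplexMultiplication.CMTypeOrbitReduction
import HarnessLib

/-!
# Milne 1999 §3 for a CM field `K` of finite degree: `γ^Ψ : (S^K, s^K) → (T^Ψ, t^Ψ)`, REMARK 3.6 («`γ^K : S^K → T^K` is
# injective»), and §6 LEMMA 6.2 for one orbit `Ψ`: the square `P^K → S^K → T^Ψ` / `P^K → L^{Π(Ψ)} → T^Ψ` commutes
# (J. S. Milne, *Lefschetz motives and the Tate conjecture*, Compositio Math. 117 (1999), §3 p. 59 L1–L8 + Remark 3.6, §6 p. 66 Lemma 6.2)

Family `hodge`, lane `lit-hodgefound` (Layer A3; seat `lit-hodgefound-p27`, generation 16, row g16-#7); topic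
`Literature/NumberTheory/ComplexMultiplication`, namespace `Literature.NumberTheory.ComplexMultiplication.CMNumbers`.  TWELFTH FILE of the
seat's Milne-1999 series.  g15-#1 `SerreGroupOrbitToriHomomorphism` formalised §3 for `K = ℚ^{cm}` (CM types on `ℚ^{cm}` = `GalCMType`,
`S = lim S^K`); this file does the FINITE LEVEL `K` (a CM field, Galois over `ℚ` where marked) that §6 needs, on the carriers of g16-#6
`CMTypeOrbitReduction` (CM types `Φ ⊂ Hom(K, ℚ^{cm})`, `λ_Φ = cmTypeChar`, `π(Φ) = cmTypeGerm`, `X^*(T^Ψ) = cmOrbitChar`, `t^Ψ = tCM`,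
`T^Ψ(R) = cmOrbitTorusPoints`, `X^*(T^Ψ) → X^*(L^{Π(Ψ)}) = redChar`, `α′^Ψ = alphaPrimePoints`), g16-#4 (`betaCharIn`/`betaPointsIn = β^Π`,
`span_setOf_zeroOne_eq_infinityTypes_cmNumbers`), g16-#3 (`alphaCharIn`/`alphaPointsIn = α^K`, `weilTorusInPoints = P^K(R)`), Q768
(`serrePoints = S^K(R)`, `constChar 1 = s^K`, `torusPoints.comap/eval`) and g15-#1's generic `OrbitTorus.liftChar`.  Small carriers with bodies
(`gammaCharK = X^*(γ^Ψ)`, `gammaPointsK = γ^Ψ`, `gammaFamilyK = γ^K`) + THEOREMS; no named fact (D-0026, net debt 0).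

THE PRINT.  [Milne1999] §3 p. 59 L1–L8 (held `paper:doi-10-1023-a-1000776613765` p0015), verbatim: «We describe the homomorphism `S^K → T^K` of
fundamental groups that it defines.  For any `Γ`-orbit `Ψ` of CM-types on `K`, the map `f ↦ Σ_{ψ∈Ψ} f(ψ)ψ : ℤ^Ψ → X^*(S^K)` factors through
`X^*(T^Ψ)` and, hence, defines a homomorphism `γ^Ψ : S^K → T^Ψ`. Its composite with `t^Ψ` is `s^K`, and so the `t^Ψ` define a homomorphism
`γ^K : (S^K, s^K) → ∏_Ψ (T^Ψ, t^Ψ)`. … Remark 3.6. The homomorphism `γ^K : S^K → T^K` is injective. Indeed, its kernel is killed by every CM-type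
on `K`, but these generate `X^*(S^K)`.»  §6 p. 66 (p0022): «Start of the proof of Theorem 6.1. Fix a CM-field `K ⊂ ℚ^{al}` finite and Galois over
`ℚ`.  LEMMA 6.2. The diagram [`T^K ←γ^K− S^K ←α^K− P^K`, `T^K ←α′^K− L^K ←β^K− P^K`] commutes.  Proof. We check this on the character groups. Let
`Ψ` be a `Γ`-orbit of CM-types on `K`, and let `f ∈ ℤ^Ψ`. Then `f` represents an element of `X^*(T^K)`, and its image in `X^*(P^K) = W^K(p^∞)`
under either map in the diagram is `∏_{ψ∈Ψ} π(ψ)^{f(ψ)}`.»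

DICTIONARY / WHAT IS FORMALISED.  `X^*(S^K) = infinityTypes Γ (K →ₐ[ℚ] ℚ^{cm}) ι` (skel-3/Q768), `s^K = constChar … 1`; for a base CM type `Φ₀`
with orbit `Ψ = ΓΦ₀`: `X^*(γ^Ψ) = gammaCharK h₀ : X^*(T^Ψ) → X^*(S^K)` (`[δ_ψ] ↦ λ_ψ`; well defined by `liftChar` since `λ_ψ + λ_{ιψ} = s^K`),
`γ^Ψ = gammaPointsK R h₀ : S^K(R) → T^Ψ(R)`, `t^Ψ ∘ γ^Ψ = s^K`; `γ^K = gammaFamilyK R S` over a set `S` of base CM types (Milne: one per orbit,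
`T^K = ∏_Ψ T^Ψ`); Remark 3.6 = `gammaFamilyK_injective` for every `S` meeting all orbits (the two points are compared as `ℤ`-linear maps on
`X^*(S^K)`, which the `λ_Φ` span — LNM 900 III (1.7), g16-#4).  Lemma 6.2 is proved ORBIT BY ORBIT (its `(K, Ψ)`-component, which is how the
printed proof checks it): on characters `alphaCharIn ∘ gammaCharK = betaCharIn ∘ redChar` (both send `[δ_ψ]` to `[π(ψ)] ∈ W^K(p^∞)`), on points
`gammaPointsK ∘ alphaPointsIn = alphaPrimePoints ∘ betaPointsIn`.

WHAT IS HERE (all PROVED):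
* §1 `cmTypeChar_add_cmTypeChar_conj` (`λ_Φ + λ_{ιΦ} = s^K`), `cmTypeChar_add_cmTypeChar_conj_orbit`, `cmTypeChar_orbit_smul`, instance
  `isTorsionFree_infinityTypes`, DEF **`gammaCharK = X^*(γ^Ψ)`** (**`gammaCharK_mk_single : [δ_ψ] ↦ λ_ψ`**, **`gammaCharK_rep`** (equivariant),
  **`gammaCharK_tCM : t^Ψ ↦ s^K`**).
* §2 DEF **`gammaPointsK = γ^Ψ : S^K(R) → T^Ψ(R)`** (`_apply_ofAdd`, `_apply_mk_single`, **`tCMPoints_gammaPointsK : t^Ψ ∘ γ^Ψ = s^K`**),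
  `apply_cmTypeChar_eq_of_gammaPointsK_eq`, **`eq_of_forall_gammaPointsK_eq`** (′), DEF **`gammaFamilyK = γ^K`** (`_apply`),
  **`gammaFamilyK_injective`** — REMARK 3.6 for `K`.
* §3 `alphaCharIn_cmTypeChar` (`X^*(α^K)(λ_Φ) = π(Φ)`), **`alphaCharIn_comp_gammaCharK`** (LEMMA 6.2 on characters, one orbit),
  **`gammaPointsK_alphaPointsIn` / `gammaPointsK_comp_alphaPointsIn`** (LEMMA 6.2 on points, one orbit); assembled over a set `S` of base
  CM types (`T^K(R) = ∏_{Φ∈S} T^{ΓΦ}(R)`, `L^K(R) = ∏_{Φ∈S} L^{Π(ΓΦ)}(R)`): DEF `betaFamilyCM = β^K` (`_apply`), DEF `alphaPrimeFamily = α′^K`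
  (`_apply`, **`alphaPrimeFamily_injective`**), **`gammaFamilyK_comp_alphaPointsIn : γ^K ∘ α^K = α′^K ∘ β^K`** (LEMMA 6.2 assembled),
  `exists_mem_orbit_cmTypeGerm` (the `π(Φ)`, `Φ ∈ S`, meet every `Γ`-orbit of `W^K_{1,+}(p^∞)` when `S` meets every orbit of CM types — g16-#6),
  **`betaFamilyCM_injective`** (`β^K` injective, g16-#4).

NOT here: the passage to the limit over `K` («On passing to the limit over all `K ⊂ ℚ^{cm}` …»); THEOREM 6.1 (`P = L ∩ S`) and the exactness
`P^K → L^K × S^K → T^K` — later rows / Layer B (B5-09); the «almost cartesian squares» Lemmas 6.3–6.4 are the separate self-contained file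
`AlmostCartesianSquares` (row g16-#8).

## References

* [Milne1999] J. S. Milne, *Lefschetz motives and the Tate conjecture*, Compositio Math. 117 (1999) 45–76 — §3 p. 59 L1–L8, Remark 3.6
  (held `paper:doi-10-1023-a-1000776613765` p0015); §6 p. 66 Lemma 6.2 (p0022 L8–L31).
* [MilneShih1982Taniyama] J. S. Milne, K.-y. Shih, *Langlands's construction of the Taniyama group*, LNM 900 (1982) art. III §1 (1.7).
* [Milne2017] J. S. Milne, *Algebraic Groups*, CUP 2017 — Ch. 12 Thm. 12.9 (Q768 `CharacterModuleTorusPoints`).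

Provenance: lane `lit-hodgefound`, seat `lit-hodgefound-p27` gen 16 (agent `literature-prover-lit-hodgefound-p27-g16-0`), row g16-#7
(INBOX 2026-08-23, claim line recorded in the seat sheet).
-/

set_option autoImplicit false

noncomputable section

open scoped NumberField Pointwise ComplexConjugate TensorProduct

namespace Literature.NumberTheory.ComplexMultiplication

namespace CMNumbers

open _root_.NumberField IsDedekindDomain Finset
open Literature.NumberTheory.NumberFields (cmNumbers cmNumbersConj coe_cmNumbersConj cmNumbersConj_mul_self cmNumbersConj_comm
  cmNumbersConj_mul_comm)
open Literature.RingTheory.GaloisAlgebras.CharacterModuleTorus (torusPoints galUnits)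
open SerreGroupTorus (infinityTypesRep coe_infinityTypesRep_apply serrePoints constChar coe_constChar)

/-! ### §1 `X^*(γ^Ψ) : X^*(T^Ψ) → X^*(S^K)`, `[f] ↦ Σ_ψ f(ψ) λ_ψ`, for a CM field `K` -/

section GammaChar

variable {K : Type} [Field K] [NumberField K] [IsCMField K]

/-- `λ_Φ + λ_{ιΦ} = s^K`, the constant character `1` of `S^K` (Q768 `constChar … 1`; «its composite with `t^Ψ` is `s^K`» on generators). [cite: Milne1999, §3 p. 59 L1–L8] -/
theorem cmTypeChar_add_cmTypeChar_conj {Φ : Set (K →ₐ[ℚ] cmNumbers)}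
    (h : IsCMTypeWith (cmNumbersConj : cmNumbers ≃ₐ[ℚ] cmNumbers) Φ)
    (h' : IsCMTypeWith (cmNumbersConj : cmNumbers ≃ₐ[ℚ] cmNumbers) ((cmNumbersConj : cmNumbers ≃ₐ[ℚ] cmNumbers) • Φ)) :
    cmTypeChar h + cmTypeChar h' = constChar (cmNumbers ≃ₐ[ℚ] cmNumbers) (K →ₐ[ℚ] cmNumbers) cmNumbersConj 1 := by
  apply Subtype.ext
  funext τ
  rw [Submodule.coe_add, Pi.add_apply, coe_constChar]
  have hinv : (cmNumbersConj : cmNumbers ≃ₐ[ℚ] cmNumbers)⁻¹ = cmNumbersConj := inv_eq_of_mul_eq_one_right cmNumbersConj_mul_self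
  by_cases hτ : τ ∈ Φ
  · have hτ' : τ ∉ (cmNumbersConj : cmNumbers ≃ₐ[ℚ] cmNumbers) • Φ := by
      rw [Set.mem_smul_set_iff_inv_smul_mem, hinv]; exact (h.mem_iff τ).mp hτ
    rw [cmTypeChar_apply_of_mem h hτ, cmTypeChar_apply_of_notMem h' hτ', add_zero]
  · have hτ' : τ ∈ (cmNumbersConj : cmNumbers ≃ₐ[ℚ] cmNumbers) • Φ := by
      rw [Set.mem_smul_set_iff_inv_smul_mem, hinv]; exact (h.rho_smul_mem_iff τ).mpr hτ
    rw [cmTypeChar_apply_of_notMem h hτ, cmTypeChar_apply_of_mem h' hτ', zero_add]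

/-- Along the orbit `Ψ = ΓΦ₀`: `λ_ψ + λ_{ιψ} = s^K` for every `ψ ∈ Ψ` — the hypothesis of g15-#1's `OrbitTorus.liftChar`. [cite: Milne1999, §3 p. 59 L1–L8] -/
theorem cmTypeChar_add_cmTypeChar_conj_orbit {Φ₀ : Set (K →ₐ[ℚ] cmNumbers)}
    (h₀ : IsCMTypeWith (cmNumbersConj : cmNumbers ≃ₐ[ℚ] cmNumbers) Φ₀) (ψ : MulAction.orbit (cmNumbers ≃ₐ[ℚ] cmNumbers) Φ₀) :
    cmTypeChar (isCMTypeWith_of_mem_orbit h₀ ψ) +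
        cmTypeChar (isCMTypeWith_of_mem_orbit h₀ ((cmNumbersConj : cmNumbers ≃ₐ[ℚ] cmNumbers) • ψ)) =
      constChar (cmNumbers ≃ₐ[ℚ] cmNumbers) (K →ₐ[ℚ] cmNumbers) cmNumbersConj 1 := by
  have e : (((cmNumbersConj : cmNumbers ≃ₐ[ℚ] cmNumbers) • ψ : MulAction.orbit (cmNumbers ≃ₐ[ℚ] cmNumbers) Φ₀) :
      Set (K →ₐ[ℚ] cmNumbers)) = (cmNumbersConj : cmNumbers ≃ₐ[ℚ] cmNumbers) • (ψ : Set (K →ₐ[ℚ] cmNumbers)) :=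
    MulAction.orbit.coe_smul
  have h' := isCMTypeWith_smul_set (isCMTypeWith_of_mem_orbit h₀ ψ) cmNumbersConj
  have hc : cmTypeChar (isCMTypeWith_of_mem_orbit h₀ ((cmNumbersConj : cmNumbers ≃ₐ[ℚ] cmNumbers) • ψ)) = cmTypeChar h' := by
    apply Subtype.ext
    funext τ
    by_cases hτ : τ ∈ (cmNumbersConj : cmNumbers ≃ₐ[ℚ] cmNumbers) • (ψ : Set (K →ₐ[ℚ] cmNumbers))
    · rw [cmTypeChar_apply_of_mem h' hτ, cmTypeChar_apply_of_mem _ (by rw [e]; exact hτ)]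
    · rw [cmTypeChar_apply_of_notMem h' hτ, cmTypeChar_apply_of_notMem _ (by rw [e]; exact hτ)]
  rw [hc]
  exact cmTypeChar_add_cmTypeChar_conj _ h'

/-- `λ_{σψ} = σ·λ_ψ` along the orbit (g16-#6 `cmTypeChar_smul`). [cite: Milne1999, §3 p. 59 L1–L8] -/
theorem cmTypeChar_orbit_smul {Φ₀ : Set (K →ₐ[ℚ] cmNumbers)}
    (h₀ : IsCMTypeWith (cmNumbersConj : cmNumbers ≃ₐ[ℚ] cmNumbers) Φ₀) (σ : cmNumbers ≃ₐ[ℚ] cmNumbers)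
    (ψ : MulAction.orbit (cmNumbers ≃ₐ[ℚ] cmNumbers) Φ₀) :
    cmTypeChar (isCMTypeWith_of_mem_orbit h₀ (σ • ψ)) =
      infinityTypesRep (cmNumbers ≃ₐ[ℚ] cmNumbers) (K →ₐ[ℚ] cmNumbers) cmNumbersConj σ (cmTypeChar (isCMTypeWith_of_mem_orbit h₀ ψ)) := by
  rw [← cmTypeChar_smul (isCMTypeWith_of_mem_orbit h₀ ψ) σ]
  have e : ((σ • ψ : MulAction.orbit (cmNumbers ≃ₐ[ℚ] cmNumbers) Φ₀) : Set (K →ₐ[ℚ] cmNumbers)) =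
      σ • (ψ : Set (K →ₐ[ℚ] cmNumbers)) := MulAction.orbit.coe_smul
  apply Subtype.ext
  funext τ
  by_cases hτ : τ ∈ σ • (ψ : Set (K →ₐ[ℚ] cmNumbers))
  · rw [cmTypeChar_apply_of_mem _ hτ, cmTypeChar_apply_of_mem _ (by rw [e]; exact hτ)]
  · rw [cmTypeChar_apply_of_notMem _ hτ, cmTypeChar_apply_of_notMem _ (by rw [e]; exact hτ)]

/-- `X^*(S^K) ⊆ ℤ^{Hom(K, ℚ^{cm})}` is torsion-free (to divide by `2` in `liftChar`). [folklore] -/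
instance isTorsionFree_infinityTypes :
    Module.IsTorsionFree ℤ (infinityTypes (cmNumbers ≃ₐ[ℚ] cmNumbers) (K →ₐ[ℚ] cmNumbers) cmNumbersConj) :=
  Submodule.instIsTorsionFree _

/-- `2 ∈ ℤ` is regular (plumbing for `liftChar`). [folklore] -/
private theorem isRegular_two_int'' : IsRegular (2 : ℤ) := IsRegular.of_ne_zero two_ne_zero

/-- **`X^*(γ^Ψ) : X^*(T^Ψ) → X^*(S^K)`, `[f] ↦ Σ_{ψ∈Ψ} f(ψ) λ_ψ`** («For any `Γ`-orbit `Ψ` of CM-types on `K`, the map `f ↦ Σ_{ψ∈Ψ} f(ψ)ψ : ℤ^Ψ →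
X^*(S^K)` factors through `X^*(T^Ψ)` and, hence, defines a homomorphism `γ^Ψ : S^K → T^Ψ`») — g15-#1's generic `OrbitTorus.liftChar` with
`v(ψ) = λ_ψ`, `c = s^K`, now for a CM field `K` of finite degree (g15-#1 did `K = ℚ^{cm}`). [cite: Milne1999, §3 p. 59 L1–L8] -/
def gammaCharK {Φ₀ : Set (K →ₐ[ℚ] cmNumbers)} (h₀ : IsCMTypeWith (cmNumbersConj : cmNumbers ≃ₐ[ℚ] cmNumbers) Φ₀) :
    cmOrbitChar ℤ Φ₀ →ₗ[ℤ] infinityTypes (cmNumbers ≃ₐ[ℚ] cmNumbers) (K →ₐ[ℚ] cmNumbers) cmNumbersConj :=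
  OrbitTorus.liftChar ℤ cmNumbersConj isRegular_two_int''
    (fun ψ : MulAction.orbit (cmNumbers ≃ₐ[ℚ] cmNumbers) Φ₀ => cmTypeChar (isCMTypeWith_of_mem_orbit h₀ ψ))
    (constChar (cmNumbers ≃ₐ[ℚ] cmNumbers) (K →ₐ[ℚ] cmNumbers) cmNumbersConj 1) (cmTypeChar_add_cmTypeChar_conj_orbit h₀)

/-- **`X^*(γ^Ψ)[δ_ψ] = λ_ψ`** («`ψ ↦ ψ`»). [cite: Milne1999, §3 p. 59 L1–L8] -/
theorem gammaCharK_mk_single {Φ₀ : Set (K →ₐ[ℚ] cmNumbers)} (h₀ : IsCMTypeWith (cmNumbersConj : cmNumbers ≃ₐ[ℚ] cmNumbers) Φ₀)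
    (ψ : MulAction.orbit (cmNumbers ≃ₐ[ℚ] cmNumbers) Φ₀) :
    gammaCharK h₀ (Submodule.Quotient.mk (Finsupp.single ψ 1)) = cmTypeChar (isCMTypeWith_of_mem_orbit h₀ ψ) :=
  OrbitTorus.liftChar_mk_single ℤ cmNumbersConj isRegular_two_int'' _ _ _ ψ

/-- **`X^*(γ^Ψ)` is `Γ`-equivariant** (`γ^Ψ` is a homomorphism of tori over `ℚ`), since `λ_{σψ} = σ·λ_ψ`. [cite: Milne1999, §3 p. 59 L1–L8] -/
theorem gammaCharK_rep {Φ₀ : Set (K →ₐ[ℚ] cmNumbers)} (h₀ : IsCMTypeWith (cmNumbersConj : cmNumbers ≃ₐ[ℚ] cmNumbers) Φ₀)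
    (σ : cmNumbers ≃ₐ[ℚ] cmNumbers) (x : cmOrbitChar ℤ Φ₀) :
    gammaCharK h₀ (cmOrbitRep ℤ Φ₀ σ x) =
      infinityTypesRep (cmNumbers ≃ₐ[ℚ] cmNumbers) (K →ₐ[ℚ] cmNumbers) cmNumbersConj σ (gammaCharK h₀ x) :=
  OrbitTorus.liftChar_rep ℤ cmNumbersConj isRegular_two_int'' _ _ _ cmNumbersConj_mul_comm
    (fun τ => (infinityTypesRep (cmNumbers ≃ₐ[ℚ] cmNumbers) (K →ₐ[ℚ] cmNumbers) cmNumbersConj τ :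
      infinityTypes (cmNumbers ≃ₐ[ℚ] cmNumbers) (K →ₐ[ℚ] cmNumbers) cmNumbersConj →ₗ[ℤ] _))
    (fun τ ψ => cmTypeChar_orbit_smul h₀ τ ψ) σ x

/-- **«Its composite with `t^Ψ` is `s^K`»** on characters: `X^*(γ^Ψ)(t^Ψ) = λ_{Φ₀} + λ_{ιΦ₀} = s^K`. [cite: Milne1999, §3 p. 59 L1–L8] -/
theorem gammaCharK_tCM {Φ₀ : Set (K →ₐ[ℚ] cmNumbers)} (h₀ : IsCMTypeWith (cmNumbersConj : cmNumbers ≃ₐ[ℚ] cmNumbers) Φ₀) :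
    gammaCharK h₀ (tCM ℤ Φ₀) = constChar (cmNumbers ≃ₐ[ℚ] cmNumbers) (K →ₐ[ℚ] cmNumbers) cmNumbersConj 1 :=
  OrbitTorus.liftChar_tChar ℤ cmNumbersConj isRegular_two_int'' _ _ _ _

end GammaChar

/-! ### §2 `γ^Ψ : (S^K, s^K) → (T^Ψ, t^Ψ)` on points and REMARK 3.6 for `K` -/

section GammaPoints

variable {K : Type} [Field K] [NumberField K] [IsCMField K]
variable (R : Type*) [CommRing R] [Algebra ℚ R]

/-- **`γ^Ψ : S^K(R) → T^Ψ(R)` ON POINTS** for every commutative `ℚ`-algebra `R` («defines a homomorphism `γ^Ψ : S^K → T^Ψ`»): Q768's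
`torusPoints.comap` of the equivariant `X^*(γ^Ψ)` (`S^K(R) = serrePoints`, Q768; `T^Ψ(R) = cmOrbitTorusPoints`, g16-#6). [cite: Milne1999, §3 p. 59 L1–L8] -/
def gammaPointsK {Φ₀ : Set (K →ₐ[ℚ] cmNumbers)} (h₀ : IsCMTypeWith (cmNumbersConj : cmNumbers ≃ₐ[ℚ] cmNumbers) Φ₀) :
    serrePoints ℚ cmNumbers K cmNumbersConj R →* cmOrbitTorusPoints R Φ₀ :=
  torusPoints.comap ℚ cmNumbers R (cmOrbitRep ℤ Φ₀)
    (infinityTypesRep (cmNumbers ≃ₐ[ℚ] cmNumbers) (K →ₐ[ℚ] cmNumbers) cmNumbersConj) (gammaCharK h₀) (gammaCharK_rep h₀)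

variable {R} in
/-- Values: `γ^Ψ(s)(x) = s(X^*(γ^Ψ) x)`. [cite: Milne1999, §3 p. 59 L1–L8] -/
theorem gammaPointsK_apply_ofAdd {Φ₀ : Set (K →ₐ[ℚ] cmNumbers)} (h₀ : IsCMTypeWith (cmNumbersConj : cmNumbers ≃ₐ[ℚ] cmNumbers) Φ₀)
    (s : serrePoints ℚ cmNumbers K cmNumbersConj R) (x : cmOrbitChar ℤ Φ₀) :
    (gammaPointsK R h₀ s : Multiplicative (cmOrbitChar ℤ Φ₀) →* (cmNumbers ⊗[ℚ] R)ˣ) (Multiplicative.ofAdd x) =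
      (s : Multiplicative (infinityTypes (cmNumbers ≃ₐ[ℚ] cmNumbers) (K →ₐ[ℚ] cmNumbers) cmNumbersConj) →* (cmNumbers ⊗[ℚ] R)ˣ)
        (Multiplicative.ofAdd (gammaCharK h₀ x)) := rfl

variable {R} in
/-- **`γ^Ψ(s)([δ_ψ]) = s(λ_ψ)`**: on the generator `[δ_ψ]` the point `γ^Ψ(s)` is the value of `s` at the CM type `ψ`. [cite: Milne1999, §3 p. 59 L1–L8] -/
theorem gammaPointsK_apply_mk_single {Φ₀ : Set (K →ₐ[ℚ] cmNumbers)}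
    (h₀ : IsCMTypeWith (cmNumbersConj : cmNumbers ≃ₐ[ℚ] cmNumbers) Φ₀) (s : serrePoints ℚ cmNumbers K cmNumbersConj R)
    (ψ : MulAction.orbit (cmNumbers ≃ₐ[ℚ] cmNumbers) Φ₀) :
    (gammaPointsK R h₀ s : Multiplicative (cmOrbitChar ℤ Φ₀) →* (cmNumbers ⊗[ℚ] R)ˣ)
        (Multiplicative.ofAdd (Submodule.Quotient.mk (Finsupp.single ψ 1))) =
      (s : Multiplicative (infinityTypes (cmNumbers ≃ₐ[ℚ] cmNumbers) (K →ₐ[ℚ] cmNumbers) cmNumbersConj) →* (cmNumbers ⊗[ℚ] R)ˣ)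
        (Multiplicative.ofAdd (cmTypeChar (isCMTypeWith_of_mem_orbit h₀ ψ))) := by
  rw [gammaPointsK_apply_ofAdd, gammaCharK_mk_single]

variable {R} in
/-- **«Its composite with `t^Ψ` is `s^K`»** on points: `t^Ψ(γ^Ψ(s)) = s^K(s)` — `γ^Ψ : (S^K, s^K) → (T^Ψ, t^Ψ)` is a morphism of PAIRS («the
`t^Ψ` define a homomorphism `γ^K : (S^K, s^K) → ∏_Ψ (T^Ψ, t^Ψ)`»). [cite: Milne1999, §3 p. 59 L1–L8] -/
theorem tCMPoints_gammaPointsK {Φ₀ : Set (K →ₐ[ℚ] cmNumbers)} (h₀ : IsCMTypeWith (cmNumbersConj : cmNumbers ≃ₐ[ℚ] cmNumbers) Φ₀)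
    (s : serrePoints ℚ cmNumbers K cmNumbersConj R) :
    tCMPoints R Φ₀ (gammaPointsK R h₀ s) =
      torusPoints.eval ℚ cmNumbers R (infinityTypesRep (cmNumbers ≃ₐ[ℚ] cmNumbers) (K →ₐ[ℚ] cmNumbers) cmNumbersConj)
        (constChar (cmNumbers ≃ₐ[ℚ] cmNumbers) (K →ₐ[ℚ] cmNumbers) cmNumbersConj 1) s :=
  (gammaPointsK_apply_ofAdd h₀ s (tCM ℤ Φ₀)).trans
    (congrArg (fun x : infinityTypes (cmNumbers ≃ₐ[ℚ] cmNumbers) (K →ₐ[ℚ] cmNumbers) cmNumbersConj =>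
        (s : Multiplicative (infinityTypes (cmNumbers ≃ₐ[ℚ] cmNumbers) (K →ₐ[ℚ] cmNumbers) cmNumbersConj) →*
          (cmNumbers ⊗[ℚ] R)ˣ) (Multiplicative.ofAdd x))
      (gammaCharK_tCM h₀))

variable {R} in
/-- The mechanism of Remark 3.6: **two points of `S^K` with the same image under `γ^Ψ`, `Ψ = ΓΦ₀`, agree at every `λ_ψ`, `ψ ∈ Ψ`**
(`γ^Ψ(x)([δ_ψ]) = x(λ_ψ)`). [cite: Milne1999, §3 p. 59 Remark 3.6] -/
theorem apply_cmTypeChar_eq_of_gammaPointsK_eq {Φ₀ : Set (K →ₐ[ℚ] cmNumbers)}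
    (h₀ : IsCMTypeWith (cmNumbersConj : cmNumbers ≃ₐ[ℚ] cmNumbers) Φ₀) {s s' : serrePoints ℚ cmNumbers K cmNumbersConj R}
    (h : gammaPointsK R h₀ s = gammaPointsK R h₀ s') (ψ : MulAction.orbit (cmNumbers ≃ₐ[ℚ] cmNumbers) Φ₀) :
    (s : Multiplicative (infinityTypes (cmNumbers ≃ₐ[ℚ] cmNumbers) (K →ₐ[ℚ] cmNumbers) cmNumbersConj) →* (cmNumbers ⊗[ℚ] R)ˣ)
        (Multiplicative.ofAdd (cmTypeChar (isCMTypeWith_of_mem_orbit h₀ ψ))) =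
      (s' : Multiplicative (infinityTypes (cmNumbers ≃ₐ[ℚ] cmNumbers) (K →ₐ[ℚ] cmNumbers) cmNumbersConj) →* (cmNumbers ⊗[ℚ] R)ˣ)
        (Multiplicative.ofAdd (cmTypeChar (isCMTypeWith_of_mem_orbit h₀ ψ))) := by
  have h1 := gammaPointsK_apply_mk_single h₀ s ψ
  have h2 := gammaPointsK_apply_mk_single h₀ s' ψ
  rw [h] at h1
  exact h1.symm.trans h2

variable {R} in
/-- **REMARK 3.6 FOR THE CM FIELD `K`: a point of `S^K(R)` is determined by its images under the `γ^Ψ`**, `Ψ` running through the orbits of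
a set `S` of base CM types meeting every `Γ`-orbit («Indeed, its kernel is killed by every CM-type on `K`, but these generate `X^*(S^K)`» — LNM 900
III (1.7) through g16-#4 `span_setOf_zeroOne_eq_infinityTypes_cmNumbers`; the two points are compared as `ℤ`-linear maps on `X^*(S^K)`, equal on
the spanning set `{λ_Φ}`, Mathlib `LinearMap.ext_on`). [cite: Milne1999, §3 p. 59 Remark 3.6] [cite: MilneShih1982Taniyama, §1 (1.7)] -/
theorem eq_of_forall_gammaPointsK_eq {S : Set (Set (K →ₐ[ℚ] cmNumbers))}
    (hS : ∀ Φ ∈ S, IsCMTypeWith (cmNumbersConj : cmNumbers ≃ₐ[ℚ] cmNumbers) Φ)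
    (hcov : ∀ Φ' : Set (K →ₐ[ℚ] cmNumbers), IsCMTypeWith (cmNumbersConj : cmNumbers ≃ₐ[ℚ] cmNumbers) Φ' →
      ∃ Φ ∈ S, Φ' ∈ MulAction.orbit (cmNumbers ≃ₐ[ℚ] cmNumbers) Φ)
    {s s' : serrePoints ℚ cmNumbers K cmNumbersConj R}
    (h : ∀ (Φ : Set (K →ₐ[ℚ] cmNumbers)) (hΦ : Φ ∈ S), gammaPointsK R (hS Φ hΦ) s = gammaPointsK R (hS Φ hΦ) s') : s = s' := by
  obtain ⟨τ₀⟩ := nonempty_algHom_cmNumbers (K := K) (Or.inr ‹IsCMField K›)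
  have hspan := span_setOf_zeroOne_eq_infinityTypes_cmNumbers (K := K) τ₀
  -- the `λ_Φ` span `X^*(S^K)` (as a module in itself)
  have htop : Submodule.span ℤ {y : infinityTypes (cmNumbers ≃ₐ[ℚ] cmNumbers) (K →ₐ[ℚ] cmNumbers) cmNumbersConj |
      (∀ τ, (y : (K →ₐ[ℚ] cmNumbers) → ℤ) τ = 0 ∨ (y : (K →ₐ[ℚ] cmNumbers) → ℤ) τ = 1) ∧
        ∀ τ, (y : (K →ₐ[ℚ] cmNumbers) → ℤ) τ + (y : (K →ₐ[ℚ] cmNumbers) → ℤ) (cmNumbersConj • τ) = 1} = ⊤ := by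
    apply Submodule.map_injective_of_injective
      (infinityTypes (cmNumbers ≃ₐ[ℚ] cmNumbers) (K →ₐ[ℚ] cmNumbers) cmNumbersConj).injective_subtype
    rw [Submodule.map_span, Submodule.map_subtype_top]
    conv_rhs => rw [← hspan]
    congr 1
    ext f
    constructor
    · rintro ⟨y, hy, rfl⟩
      exact hy
    · intro hf
      have hf' : f ∈ infinityTypes (cmNumbers ≃ₐ[ℚ] cmNumbers) (K →ₐ[ℚ] cmNumbers) cmNumbersConj := by
        rw [← hspan]; exact Submodule.subset_span hf
      exact ⟨⟨f, hf'⟩, hf, rfl⟩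
  -- the two points as `ℤ`-linear maps `X^*(S^K) → Additive ((ℚ^{cm} ⊗ R)ˣ)`
  have hSS' : (MonoidHom.toAdditiveRight
        (s : Multiplicative (infinityTypes (cmNumbers ≃ₐ[ℚ] cmNumbers) (K →ₐ[ℚ] cmNumbers) cmNumbersConj) →*
          (cmNumbers ⊗[ℚ] R)ˣ)).toIntLinearMap =
      (MonoidHom.toAdditiveRight
        (s' : Multiplicative (infinityTypes (cmNumbers ≃ₐ[ℚ] cmNumbers) (K →ₐ[ℚ] cmNumbers) cmNumbersConj) →*
          (cmNumbers ⊗[ℚ] R)ˣ)).toIntLinearMap := by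
    refine LinearMap.ext_on htop fun y hy => ?_
    have hy' := isCMTypeWith_setOf_eq_one hy.1 hy.2
    obtain ⟨Φ, hΦ, hmem⟩ := hcov _ hy'
    have he : y = cmTypeChar (isCMTypeWith_of_mem_orbit (hS Φ hΦ) ⟨_, hmem⟩) :=
      Subtype.ext (coe_cmTypeChar_setOf_eq_one hy.1 hy.2).symm
    rw [he]
    exact congrArg Additive.ofMul (apply_cmTypeChar_eq_of_gammaPointsK_eq (hS Φ hΦ) (h Φ hΦ) ⟨_, hmem⟩)
  apply Subtype.ext
  apply MonoidHom.ext
  intro x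
  exact congrArg Additive.toMul (LinearMap.congr_fun hSS' (Multiplicative.toAdd x))

variable {R} in
/-- The same with ALL CM types of `K` as base points. [cite: Milne1999, §3 p. 59 Remark 3.6] -/
theorem eq_of_forall_gammaPointsK_eq' {s s' : serrePoints ℚ cmNumbers K cmNumbersConj R}
    (h : ∀ (Φ₀ : Set (K →ₐ[ℚ] cmNumbers)) (h₀ : IsCMTypeWith (cmNumbersConj : cmNumbers ≃ₐ[ℚ] cmNumbers) Φ₀),
      gammaPointsK R h₀ s = gammaPointsK R h₀ s') : s = s' :=
  eq_of_forall_gammaPointsK_eq (S := {Φ | IsCMTypeWith (cmNumbersConj : cmNumbers ≃ₐ[ℚ] cmNumbers) Φ}) (fun _ hΦ => hΦ)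
    (fun Φ' hΦ' => ⟨Φ', hΦ', MulAction.mem_orbit_self Φ'⟩) fun Φ hΦ => h Φ hΦ

/-- **`γ^K = (γ^Ψ)_Ψ : S^K(R) → T^K(R) = ∏_Ψ T^Ψ(R)`**, the product over a set `S` of base CM types (Milne: one base point per `Γ`-orbit,
`T^K = ∏_Ψ T^Ψ`; any `S` meeting every orbit gives the same injectivity statement). [cite: Milne1999, §3 p. 59 L1–L8] -/
def gammaFamilyK (S : Set (Set (K →ₐ[ℚ] cmNumbers))) (hS : ∀ Φ ∈ S, IsCMTypeWith (cmNumbersConj : cmNumbers ≃ₐ[ℚ] cmNumbers) Φ) :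
    serrePoints ℚ cmNumbers K cmNumbersConj R →* ∀ Φ : S, cmOrbitTorusPoints R (Φ : Set (K →ₐ[ℚ] cmNumbers)) :=
  MonoidHom.pi fun Φ => gammaPointsK R (hS Φ Φ.2)

variable {R} in
/-- [cite: Milne1999, §3 p. 59 L1–L8] -/
@[simp] theorem gammaFamilyK_apply (S : Set (Set (K →ₐ[ℚ] cmNumbers)))
    (hS : ∀ Φ ∈ S, IsCMTypeWith (cmNumbersConj : cmNumbers ≃ₐ[ℚ] cmNumbers) Φ) (s : serrePoints ℚ cmNumbers K cmNumbersConj R) (Φ : S) :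
    gammaFamilyK R S hS s Φ = gammaPointsK R (hS Φ Φ.2) s := rfl

variable {R} in
/-- **REMARK 3.6: «The homomorphism `γ^K : S^K → T^K` is injective»** — on `R`-points for every commutative `ℚ`-algebra `R` and every set
`S` of base CM types meeting every `Γ`-orbit. [cite: Milne1999, §3 p. 59 Remark 3.6] -/
theorem gammaFamilyK_injective {S : Set (Set (K →ₐ[ℚ] cmNumbers))}
    (hS : ∀ Φ ∈ S, IsCMTypeWith (cmNumbersConj : cmNumbers ≃ₐ[ℚ] cmNumbers) Φ)
    (hcov : ∀ Φ' : Set (K →ₐ[ℚ] cmNumbers), IsCMTypeWith (cmNumbersConj : cmNumbers ≃ₐ[ℚ] cmNumbers) Φ' →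
      ∃ Φ ∈ S, Φ' ∈ MulAction.orbit (cmNumbers ≃ₐ[ℚ] cmNumbers) Φ) :
    Function.Injective (gammaFamilyK R S hS) := by
  intro s s' h
  exact eq_of_forall_gammaPointsK_eq hS hcov fun Φ hΦ => by
    have := congrFun h ⟨Φ, hΦ⟩
    simpa only [gammaFamilyK_apply] using this

end GammaPoints

/-! ### §3 LEMMA 6.2 for one orbit `Ψ`: `X^*(α^K) ∘ X^*(γ^Ψ) = X^*(β^{Π(Ψ)}) ∘ (X^*(T^Ψ) → X^*(L^{Π(Ψ)}))` and the square on points -/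

section Lemma62

variable {K : Type} [Field K] [NumberField K] [IsCMField K] [IsGalois ℚ K]
variable (p : ℕ) [hp : Fact p.Prime] (𝔭 : Ideal (𝓞 K)) [h𝔭 : 𝔭.LiesOver (Ideal.span {(p : ℤ)})] [h𝔭P : 𝔭.IsPrime]
variable (τ₀ : K →ₐ[ℚ] cmNumbers)

/-- `X^*(α^K)(λ_Φ) = π(Φ)` in `X^*(P^K) = W^K(p^∞)` (g16-#3 `alphaCharIn`, g16-#6 `cmTypeGerm`; definitional). [cite: Milne1999, §5 pp. 64–65 («The reduction functor»)] -/
theorem alphaCharIn_cmTypeChar {Φ : Set (K →ₐ[ℚ] cmNumbers)} (h : IsCMTypeWith (cmNumbersConj : cmNumbers ≃ₐ[ℚ] cmNumbers) Φ) :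
    alphaCharIn p 𝔭 τ₀ (cmTypeChar h) = Additive.ofMul ⟨cmTypeGerm p 𝔭 h, (cmTypeGerm_mem_weilLimitInOnePlus p 𝔭 τ₀ h).1⟩ := rfl

/-- **LEMMA 6.2 ON CHARACTERS (one orbit `Ψ = ΓΦ₀`)**: `X^*(α^K) ∘ X^*(γ^Ψ) = X^*(β^{Π(Ψ)}) ∘ (X^*(T^Ψ) → X^*(L^{Π(Ψ)}))` as maps
`X^*(T^Ψ) → X^*(P^K) = W^K(p^∞)` — «We check this on the character groups. Let `Ψ` be a `Γ`-orbit of CM-types on `K`, and let `f ∈ ℤ^Ψ`. Then `f`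
represents an element of `X^*(T^K)`, and its image in `X^*(P^K) = W^K(p^∞)` under either map in the diagram is `∏_{ψ∈Ψ} π(ψ)^{f(ψ)}`.»
(both composites send `[δ_ψ]` to `[π(ψ)]`: g16-#6 `redChar_mk_single`, g16-#4 `betaCharIn_mk_single`, and `X^*(α^K)(λ_ψ) = π(ψ)`).
[cite: Milne1999, §6 p. 66 Lemma 6.2] -/
theorem alphaCharIn_comp_gammaCharK {Φ₀ : Set (K →ₐ[ℚ] cmNumbers)}
    (h₀ : IsCMTypeWith (cmNumbersConj : cmNumbers ≃ₐ[ℚ] cmNumbers) Φ₀) :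
    (alphaCharIn p 𝔭 τ₀).comp (gammaCharK h₀) =
      (betaCharIn p τ₀ (cmTypeGerm p 𝔭 h₀) (cmTypeGerm_mem_weilLimitInOnePlus p 𝔭 τ₀ h₀)).comp (redChar p 𝔭 h₀) := by
  apply Submodule.linearMap_qext
  apply Finsupp.lhom_ext'
  intro ψ
  apply LinearMap.ext_ring
  change (alphaCharIn p 𝔭 τ₀) (gammaCharK h₀ (Submodule.Quotient.mk (Finsupp.single ψ 1))) =
    (betaCharIn p τ₀ (cmTypeGerm p 𝔭 h₀) (cmTypeGerm_mem_weilLimitInOnePlus p 𝔭 τ₀ h₀))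
      (redChar p 𝔭 h₀ (Submodule.Quotient.mk (Finsupp.single ψ 1)))
  rw [gammaCharK_mk_single, redChar_mk_single, betaCharIn_mk_single, alphaCharIn_cmTypeChar]
  rfl

variable (R : Type*) [CommRing R] [Algebra ℚ R]

variable {R} in
/-- **LEMMA 6.2 ON POINTS (one orbit `Ψ`): the square `P^K(R) → S^K(R) → T^Ψ(R)` / `P^K(R) → L^{Π(Ψ)}(R) → T^Ψ(R)` commutes**, i.e.
`γ^Ψ ∘ α^K = α′^Ψ ∘ β^{Π(Ψ)}` on `P^K(R)` for every commutative `ℚ`-algebra `R` (g16-#3 `alphaPointsIn = α^K`, g16-#4 `betaPointsIn = β^Π`, g16-#6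
`alphaPrimePoints = α′^Ψ`) — the `(K, Ψ)`-component of «The diagram `T^K ← S^K ← P^K`, `T^K ← L^K ← P^K` commutes». [cite: Milne1999, §6 p. 66 Lemma 6.2] -/
theorem gammaPointsK_alphaPointsIn {Φ₀ : Set (K →ₐ[ℚ] cmNumbers)}
    (h₀ : IsCMTypeWith (cmNumbersConj : cmNumbers ≃ₐ[ℚ] cmNumbers) Φ₀) (f : weilTorusInPoints p τ₀ R) :
    gammaPointsK R h₀ (alphaPointsIn p 𝔭 τ₀ R f) =
      alphaPrimePoints p 𝔭 R h₀
        (betaPointsIn p τ₀ R (cmTypeGerm p 𝔭 h₀) (cmTypeGerm_mem_weilLimitInOnePlus p 𝔭 τ₀ h₀) f) := by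
  apply Subtype.ext
  apply MonoidHom.ext
  intro x
  have h := LinearMap.congr_fun (alphaCharIn_comp_gammaCharK p 𝔭 τ₀ h₀) (Multiplicative.toAdd x)
  simp only [LinearMap.comp_apply] at h
  exact congrArg (fun y : Additive (weilLimitIn K p τ₀) =>
    (f : Multiplicative (Additive (weilLimitIn K p τ₀)) →* (cmNumbers ⊗[ℚ] R)ˣ) (Multiplicative.ofAdd y)) h

/-- Lemma 6.2 (one orbit) as an equality of homomorphisms `P^K(R) → T^Ψ(R)`. [cite: Milne1999, §6 p. 66 Lemma 6.2] -/
theorem gammaPointsK_comp_alphaPointsIn {Φ₀ : Set (K →ₐ[ℚ] cmNumbers)}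
    (h₀ : IsCMTypeWith (cmNumbersConj : cmNumbers ≃ₐ[ℚ] cmNumbers) Φ₀) :
    (gammaPointsK R h₀).comp (alphaPointsIn p 𝔭 τ₀ R) =
      (alphaPrimePoints p 𝔭 R h₀).comp
        (betaPointsIn p τ₀ R (cmTypeGerm p 𝔭 h₀) (cmTypeGerm_mem_weilLimitInOnePlus p 𝔭 τ₀ h₀)) :=
  MonoidHom.ext fun f => gammaPointsK_alphaPointsIn p 𝔭 τ₀ h₀ f

/-! #### The square assembled over a set of base CM types: `T^K = ∏_Ψ T^Ψ`, `L^K = ∏_Ψ L^{Π(Ψ)}` -/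

/-- **`β^K` indexed by base CM types**: `P^K(R) → ∏_{Φ ∈ S} L^{Π(ΓΦ)}(R)`, the `Φ`-component being `β^{Π(ΓΦ)}` (g16-#4 `betaPointsIn` at the
orbit of `π(Φ)`; by g16-#6 every `Γ`-orbit of `W^K_{1,+}(p^∞)` is such a `Π(ΓΦ)`, so for `S` meeting every orbit of CM types this is Milne's
`β^K : P^K → L^K = ∏_Π L^Π` up to the indexing). [cite: Milne1999, §4 p. 62 L20–L21, §6 p. 66 Lemma 6.2] -/
def betaFamilyCM (S : Set (Set (K →ₐ[ℚ] cmNumbers))) (hS : ∀ Φ ∈ S, IsCMTypeWith (cmNumbersConj : cmNumbers ≃ₐ[ℚ] cmNumbers) Φ) :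
    weilTorusInPoints p τ₀ R →* ∀ Φ : S, weilOrbitTorusPoints R (cmTypeGerm p 𝔭 (hS Φ Φ.2)) :=
  MonoidHom.pi fun Φ => betaPointsIn p τ₀ R (cmTypeGerm p 𝔭 (hS Φ Φ.2)) (cmTypeGerm_mem_weilLimitInOnePlus p 𝔭 τ₀ (hS Φ Φ.2))

variable {R} in
/-- [cite: Milne1999, §6 p. 66 Lemma 6.2] -/
@[simp] theorem betaFamilyCM_apply (S : Set (Set (K →ₐ[ℚ] cmNumbers)))
    (hS : ∀ Φ ∈ S, IsCMTypeWith (cmNumbersConj : cmNumbers ≃ₐ[ℚ] cmNumbers) Φ) (f : weilTorusInPoints p τ₀ R) (Φ : S) :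
    betaFamilyCM p 𝔭 τ₀ R S hS f Φ =
      betaPointsIn p τ₀ R (cmTypeGerm p 𝔭 (hS Φ Φ.2)) (cmTypeGerm_mem_weilLimitInOnePlus p 𝔭 τ₀ (hS Φ Φ.2)) f := rfl

omit [IsGalois ℚ K] in
/-- **`α′^K = (α′^Ψ)_Ψ : L^K(R) = ∏_{Φ ∈ S} L^{Π(ΓΦ)}(R) → T^K(R) = ∏_{Φ ∈ S} T^{ΓΦ}(R)`**, componentwise g16-#6's `alphaPrimePoints` («On combining these
maps for all `Ψ`, we obtain a injective homomorphism `α′^K : (L^K, l^K) → (T^K, t^K)`»). [cite: Milne1999, §5 p. 65 L8–L9] -/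
def alphaPrimeFamily (S : Set (Set (K →ₐ[ℚ] cmNumbers))) (hS : ∀ Φ ∈ S, IsCMTypeWith (cmNumbersConj : cmNumbers ≃ₐ[ℚ] cmNumbers) Φ) :
    (∀ Φ : S, weilOrbitTorusPoints R (cmTypeGerm p 𝔭 (hS Φ Φ.2))) →* ∀ Φ : S, cmOrbitTorusPoints R (Φ : Set (K →ₐ[ℚ] cmNumbers)) :=
  MonoidHom.pi fun Φ => (alphaPrimePoints p 𝔭 R (hS Φ Φ.2)).comp (Pi.evalMonoidHom _ Φ)

variable {R} in
omit [IsGalois ℚ K] in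
/-- [cite: Milne1999, §5 p. 65 L8–L9] -/
@[simp] theorem alphaPrimeFamily_apply (S : Set (Set (K →ₐ[ℚ] cmNumbers)))
    (hS : ∀ Φ ∈ S, IsCMTypeWith (cmNumbersConj : cmNumbers ≃ₐ[ℚ] cmNumbers) Φ)
    (f : ∀ Φ : S, weilOrbitTorusPoints R (cmTypeGerm p 𝔭 (hS Φ Φ.2))) (Φ : S) :
    alphaPrimeFamily p 𝔭 R S hS f Φ = alphaPrimePoints p 𝔭 R (hS Φ Φ.2) (f Φ) := rfl

variable {R} in
omit [IsGalois ℚ K] in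
/-- **`α′^K` is injective** (componentwise, g16-#6 `alphaPrimePoints_injective`). [cite: Milne1999, §5 p. 65 L8–L9] -/
theorem alphaPrimeFamily_injective (S : Set (Set (K →ₐ[ℚ] cmNumbers)))
    (hS : ∀ Φ ∈ S, IsCMTypeWith (cmNumbersConj : cmNumbers ≃ₐ[ℚ] cmNumbers) Φ) :
    Function.Injective (alphaPrimeFamily p 𝔭 R S hS) := by
  intro f g h
  funext Φ
  exact alphaPrimePoints_injective p 𝔭 (hS Φ Φ.2) (by simpa only [alphaPrimeFamily_apply] using congrFun h Φ)

/-- **LEMMA 6.2 assembled: `γ^K ∘ α^K = α′^K ∘ β^K : P^K(R) → T^K(R)`** for `T^K(R) = ∏_{Φ∈S} T^{ΓΦ}(R)`, `L^K(R) = ∏_{Φ∈S} L^{Π(ΓΦ)}(R)` over any set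
`S` of base CM types (Milne: one per `Γ`-orbit). [cite: Milne1999, §6 p. 66 Lemma 6.2] -/
theorem gammaFamilyK_comp_alphaPointsIn (S : Set (Set (K →ₐ[ℚ] cmNumbers)))
    (hS : ∀ Φ ∈ S, IsCMTypeWith (cmNumbersConj : cmNumbers ≃ₐ[ℚ] cmNumbers) Φ) :
    (gammaFamilyK R S hS).comp (alphaPointsIn p 𝔭 τ₀ R) = (alphaPrimeFamily p 𝔭 R S hS).comp (betaFamilyCM p 𝔭 τ₀ R S hS) := by
  apply MonoidHom.ext
  intro f
  funext Φ
  exact gammaPointsK_alphaPointsIn p 𝔭 τ₀ (hS Φ Φ.2) f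

variable {R} in
/-- For `S` meeting every `Γ`-orbit of CM types, the germs `π(Φ)`, `Φ ∈ S`, meet every `Γ`-orbit of `W^K_{1,+}(p^∞)` (g16-#6 `exists_cmTypeGerm_eq`:
every germ is a `π(Φ′)`, and `π(σΦ) = σπ(Φ)`). [cite: Milne1999, §5 pp. 64–65 («The reduction functor»)] -/
theorem exists_mem_orbit_cmTypeGerm {S : Set (Set (K →ₐ[ℚ] cmNumbers))}
    (hS : ∀ Φ ∈ S, IsCMTypeWith (cmNumbersConj : cmNumbers ≃ₐ[ℚ] cmNumbers) Φ)
    (hcov : ∀ Φ' : Set (K →ₐ[ℚ] cmNumbers), IsCMTypeWith (cmNumbersConj : cmNumbers ≃ₐ[ℚ] cmNumbers) Φ' →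
      ∃ Φ ∈ S, Φ' ∈ MulAction.orbit (cmNumbers ≃ₐ[ℚ] cmNumbers) Φ)
    {x : WeilLimit p} (hx : x ∈ weilLimitInOnePlus K p τ₀) :
    ∃ (Φ : Set (K →ₐ[ℚ] cmNumbers)) (hΦ : Φ ∈ S), x ∈ MulAction.orbit (cmNumbers ≃ₐ[ℚ] cmNumbers) (cmTypeGerm p 𝔭 (hS Φ hΦ)) := by
  obtain ⟨Φ', h', rfl⟩ := exists_cmTypeGerm_eq p 𝔭 τ₀ hx
  obtain ⟨Φ, hΦ, hmem⟩ := hcov Φ' h'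
  refine ⟨Φ, hΦ, ?_⟩
  have e := coe_orbitRed p 𝔭 (hS Φ hΦ) ⟨Φ', hmem⟩
  rw [← cmTypeGerm_congr p 𝔭 h' (isCMTypeWith_of_mem_orbit (hS Φ hΦ) ⟨Φ', hmem⟩) rfl, ← e]
  exact (orbitRed p 𝔭 (hS Φ hΦ) ⟨Φ', hmem⟩).2

variable {R} in
/-- **`β^K` (indexed by base CM types meeting every orbit) is injective** — g16-#4's `eq_of_forall_betaPointsIn_eq` with the base points
`π(Φ)`, `Φ ∈ S`. [cite: Milne1999, §4 p. 62 L20–L23] -/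
theorem betaFamilyCM_injective {S : Set (Set (K →ₐ[ℚ] cmNumbers))}
    (hS : ∀ Φ ∈ S, IsCMTypeWith (cmNumbersConj : cmNumbers ≃ₐ[ℚ] cmNumbers) Φ)
    (hcov : ∀ Φ' : Set (K →ₐ[ℚ] cmNumbers), IsCMTypeWith (cmNumbersConj : cmNumbers ≃ₐ[ℚ] cmNumbers) Φ' →
      ∃ Φ ∈ S, Φ' ∈ MulAction.orbit (cmNumbers ≃ₐ[ℚ] cmNumbers) Φ) :
    Function.Injective (betaFamilyCM p 𝔭 τ₀ R S hS) := by
  intro f f' h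
  refine eq_of_forall_betaPointsIn_eq p τ₀ (R := R)
    (S := {x | ∃ (Φ : Set (K →ₐ[ℚ] cmNumbers)) (hΦ : Φ ∈ S), cmTypeGerm p 𝔭 (hS Φ hΦ) = x}) ?_ ?_ ?_
  · rintro _ ⟨Φ, hΦ, rfl⟩
    exact cmTypeGerm_mem_weilLimitInOnePlus p 𝔭 τ₀ (hS Φ hΦ)
  · intro x hx
    obtain ⟨Φ, hΦ, hmem⟩ := exists_mem_orbit_cmTypeGerm p 𝔭 τ₀ hS hcov hx
    exact ⟨_, ⟨Φ, hΦ, rfl⟩, hmem⟩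
  · rintro _ ⟨Φ, hΦ, rfl⟩
    have := congrFun h ⟨Φ, hΦ⟩
    simpa only [betaFamilyCM_apply] using this

end Lemma62

end CMNumbers

end Literature.NumberTheory.ComplexMultiplication

end
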